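import Literature.Computability.Complexity.StringCopy
import Literature.Computability.Complexity.CookReducibilityTransitive

/-!
# `CompactnessPrinciple` (stmt-QuantumAdvantage-15270), line `universal-clock-padding` — stub `stub_instMap`

**The instance map `ρ_e : W ↦ ⟨e, ⟨W, ε⟩⟩ = boolPair e (boolPair W [])` is linear time** on
Mathlib's TM2 model: `∃ a, TimeComputable id id ρ_e (fun n => a · n + a)` (indeed `a = 15`).

## Proof (three tree machines, sequential composition)

`boolPair e (boolPair W []) = boolPair e [] ++ rePair (dup W)` with `dup W` the doubled string
(`StrCopy.dup`, `StrCopy.rePair_dup : rePair (dup W) = boolPair W []`). Run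

1. the doubling transducer `StrCopy.dupT` (`dupT_eval : dupT.eval = dup`, machine from
   `FST.timeComputable_eval`, time `(maxEmit + 1) · n + 3 ≤ 3n + 3` as `maxEmit dupT ≤ 2`);
2. the re-pairing machine `RePairTM.aux` (`RePairTM.outputsWithin`: `rePair z` within
   `4 |z| + 5 = 8n + 5` steps on `z = dup W`, `|dup W| = 2n`);
3. the prefixing transducer `OracleCompose.prefixT (boolPair e [])` (copies every symbol and
   prepends `boolPair e []`; `prefixT_eval : (prefixT l).eval w = l ++ w`, time
   `(maxEmit + 1) · (2n + 2) + 3 ≤ 4n + 7` as `maxEmit (prefixT l) ≤ 1`),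

chained by `Turing.TM2ComputableAux.comp_outputsWithin` (additive running time): total
`3n + 3 + 8n + 5 + 4n + 7 = 15 n + 15`.

References: S. Arora, B. Barak, *Computational Complexity: A Modern Approach*, CUP 2009, §0.1
(pairing), §1.3 (machine composition); J. E. Hopcroft, J. D. Ullman, *Introduction to Automata
Theory, Languages, and Computation*, 1979, §2.7 (Mealy machines).
-/

-- the Summit.QuantumAdvantage.QuantumAdvantage.… namespace repeats summit = sub-problem (D-0017 layout)
set_option linter.dupNamespace false

namespace Summit.QuantumAdvantage.QuantumAdvantage.Theorems

open Literature.Computability.Complexity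

/-- The prefixing transducer emits one symbol per input symbol: `maxEmit ≤ 1`. [folklore] -/
private theorem maxEmit_prefixT_le (l : List Bool) : (OracleCompose.prefixT l).maxEmit ≤ 1 :=
  Finset.sup_le fun p _ => by simp [OracleCompose.prefixT]

/-- The doubling transducer emits two symbols per input symbol: `maxEmit ≤ 2`. [folklore] -/
private theorem maxEmit_dupT_le : StrCopy.dupT.maxEmit ≤ 2 :=
  Finset.sup_le fun p _ => by simp [StrCopy.dupT]

/-- Length of a doubled string: `|dup W| = 2 |W|`. [folklore] -/
private theorem length_dup (W : List Bool) : (StrCopy.dup W).length = 2 * W.length := by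
  induction W with
  | nil => rfl
  | cons b W ih =>
    simp only [StrCopy.dup, List.flatMap_cons, List.length_append, List.length_cons,
      List.length_nil] at ih ⊢
    omega

/-- `⟨e, ε⟩ ++ z = ⟨e, z⟩`: the pairing is a prefix code in its first component.
[Arora–Barak 2009, §0.1] [folklore] -/
private theorem boolPair_nil_append (e z : List Bool) : boolPair e [] ++ z = boolPair e z := by
  simp [boolPair]

/-- **The instance map `W ↦ ⟨e, ⟨W, ε⟩⟩` is linear time** (`15 n + 15` steps): doubling
transducer, re-pairing machine, prefixing transducer, composed sequentially.
[Arora–Barak 2009, §0.1, §1.3] [folklore] -/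
theorem stub_instMap (e : List Bool) :
    ∃ a : ℕ, TimeComputable id id (fun W : List Bool => boolPair e (boolPair W []))
      fun n => a * n + a := by
  obtain ⟨M₁, h₁⟩ := StrCopy.dupT.timeComputable_eval
  obtain ⟨M₃, h₃⟩ := (OracleCompose.prefixT (boolPair e [])).timeComputable_eval
  have hd := maxEmit_dupT_le
  have hf := maxEmit_prefixT_le (boolPair e [])
  refine ⟨15, (M₁.comp RePairTM.aux).comp M₃, fun W => ?_⟩
  -- stage 1: `W ↦ dup W` within `3n + 3`
  have H₁ : M₁.OutputsWithin W (StrCopy.dup W) (3 * W.length + 3) := by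
    have h := h₁ W
    simp only [id, StrCopy.dupT_eval] at h
    refine h.mono ?_
    have hK := Nat.mul_le_mul_right W.length (show StrCopy.dupT.maxEmit + 1 ≤ 3 by omega)
    omega
  -- stage 2: `dup W ↦ rePair (dup W) = boolPair W []` within `8n + 5`
  have H₂ : RePairTM.aux.OutputsWithin (StrCopy.dup W) (boolPair W []) (8 * W.length + 5) := by
    have h := RePairTM.outputsWithin (StrCopy.dup W)
    rw [StrCopy.rePair_dup, length_dup] at h
    refine h.mono ?_
    omega
  -- stage 3: `boolPair W [] ↦ boolPair e [] ++ boolPair W [] = boolPair e (boolPair W [])` within `4n + 7`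
  have H₃ : M₃.OutputsWithin (boolPair W []) (boolPair e (boolPair W [])) (4 * W.length + 7) := by
    have h := h₃ (boolPair W [])
    simp only [id, OracleCompose.prefixT_eval, boolPair_nil_append, length_boolPair,
      List.length_nil, Nat.add_zero] at h
    refine h.mono ?_
    have hK := Nat.mul_le_mul_right (2 * W.length + 2)
      (show (OracleCompose.prefixT (boolPair e [])).maxEmit + 1 ≤ 2 by omega)
    omega
  have H := Turing.TM2ComputableAux.comp_outputsWithin _ _
    (Turing.TM2ComputableAux.comp_outputsWithin _ _ H₁ H₂) H₃
  refine H.mono ?_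
  show 4 * W.length + 7 + (8 * W.length + 5 + (3 * W.length + 3)) ≤ 15 * W.length + 15
  omega

end Summit.QuantumAdvantage.QuantumAdvantage.Theorems
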